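import Mathlib
import Literature.MathematicalPhysics.QuantumFieldTheory.Balaban1983to89.B5Block118
import Literature.MathematicalPhysics.QuantumFieldTheory.BalabanImbrieJaffe1984to88.BIJ85MomentumSymbols6I
import Literature.MathematicalPhysics.QuantumFieldTheory.BalabanImbrieJaffe1984to88.BIJ85Eq716ConfigLaplacian

/-!
# `BalabanImbrieJaffe1984to88.BIJ85Eq714FineTorus` — T. Bałaban, J. Imbrie, A. Jaffe, *Renormalization of the Higgs model:
minimizers, propagators and the stability of mean field theory*, Commun. Math. Phys. **97** (1985) 299–329
[BalabanImbrieJaffe1985]: Sect. 7.1 p. 322 — **(7.1.4) `∂_μ(p) = (exp(iηp_μ) − 1)/η` and the η-lattice member of (7.1.6)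
`Δ(p) = Tr ∂(p)^*∂(p)` FROM CONFIGURATION SPACE on the η-lattice torus**: the forward difference `η^{−1}(S_ν − 1)` on
multi-component fields over the fine torus `T_η` (`n = η^{−1}` fine sites per unit site) has, at the fine dual momentum
`p = p′ + l` (coarse class `p′ ↔ q`, offset `l = 2πk`), the symbol `∂_ν(p′ + l)·1` — r15's `BIJ85MomentumSymbols71.dSym (1/n)` at
`p′ + l = B4Strip.shiftr n k (sOf M q)` — and the η-Laplacian `Σ_ν ∂_ν^*∂_ν` has symbol `Δ(p′ + l)·1` (r15's `lapSym (1/n)`) —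
file 9 of the (7.1.2) cluster (`BIJ85Eq715ConfigSymbols`, `BIJ85Eq716ConfigLaplacian`)

statement-level skeleton of published theorems with citation tags; proofs where landed; nothing here is a claim about
the Yang–Mills mass gap

PDF held: `paper:balaban1985-cmp97-bij-higgs-minimizers` (journal page = PDF page + 298).  Text read: PDF p. 24 (journal 322).

CITATION HEADER (lean-in-tree rule).  Part of the lit-balaban TYPED SKELETON (HOME `run/shared/lean/pub/lit-balaban/`); WHAT IS
REPRODUCED: displays **(7.1.4)** and **(7.1.6)** (η-member) of SKELETON row **C1.Eq7.1.2-7.1.12** (p. 322 [PDF 24], verbatim: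
*"Since we have two special lattice scales, the unit lattice leading to momenta |p_i| ≤ π and the η = L^{−k} lattice leading to
momenta |p_i| ≤ π/η, we require operators on both scales. … the derivative ∂ can be represented by a diagonal d × d matrix ∂(p)
with eigenvalues ∂_μ(p) = (exp(iηp_μ) − 1)/η. (7.1.4) … The corresponding Laplacians are Δ(p) = Tr ∂(p)^*∂(p), … (7.1.6)"*;
typed by r15 as `dSym η p μ`, `lapSym η p`), `HOME/lit-balaban-r15/ROWS-C1.md` (owner r15, referee ref-5).  TYPED READING: the
η-lattice torus with `n = η^{−1}` fine sites per unit-lattice site and `M_μ` unit sites is `Tor (fine n M)` of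
`Balaban1983to89.B5Prop11Plancherel` (`fine n M μ = n·M_μ`); its dual momenta are parametrised as `p = p′ + l` by
`Balaban1983to89.B5Block118.pOf n M (k, q)` (coarse class `q : Tor M`, `p′ = sOf M q ∈ [−π,π]^d`; offset `k : (Fin n)^d`,
`l = 2πk`; [Balaban1984PropagatorsI] (1.31)); the η-lattice forward difference with the lattice factor `η^{−1} = n` is
`(n : ℂ) • fdiffC (fine n M) m ν` (`BIJ85Eq715ConfigSymbols.fdiffC` = `S_ν − 1`); `p′ + l` as a real vector is
`Balaban1983to89.B4Strip.shiftr n k (sOf M q)`.  WHAT IS KERNEL-CHECKED (zero `sorry`, standard axioms): `exp_sOf_pOf` (the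
reduced fine momentum of `p′ + l` has `e^{i s_ν} = ω_ν = e^{iη(p′_ν + l_ν)}`, `B5Block118.om`), `natCast_mul_dOne_sOf_pOf`
(`n·∂^{(1),η‑torus}_ν = ∂_ν(p′+l)` = r15's `dSym (1/n) (p′+l) ν`, via seat p10's dictionary `BIJ85MomentumSymbols6I.dSym_eq_6I`),
**`symb_fdiffC_fine`** ((7.1.4) PROVED as the symbol of the configuration-space η-difference at `p′ + l`),
`dftC_fdiffC_fine_mulVec` (momentum representation), `lapSym_shiftr_eq`, **`symb_laplace_fine`** ((7.1.6) η-member: the symbol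
of `Σ_ν (η^{−1}∂_ν)^*(η^{−1}∂_ν)` at `p′ + l` is `Δ(p′+l)·1 = lapSym (1/n) (p′+l)·1`).  Unit `lit-balaban-p27` (gen 4).
-/

namespace Literature.MathematicalPhysics.QuantumFieldTheory.BalabanImbrieJaffe1984to88.BIJ85Eq714FineTorus

open scoped BigOperators Matrix ComplexConjugate
open Finset Complex
open Literature.MathematicalPhysics.QuantumFieldTheory.Balaban1983to89
open Literature.MathematicalPhysics.QuantumFieldTheory.Balaban1983to89.B5Prop11Plancherel
open Literature.MathematicalPhysics.QuantumFieldTheory.Balaban1983to89.B5Block118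
open Literature.MathematicalPhysics.QuantumFieldTheory.BalabanImbrieJaffe1984to88.BIJ85Eq712Plancherel
open Literature.MathematicalPhysics.QuantumFieldTheory.BalabanImbrieJaffe1984to88.BIJ85Eq712SymbolCalculus
open Literature.MathematicalPhysics.QuantumFieldTheory.BalabanImbrieJaffe1984to88.BIJ85Eq715ConfigSymbols
open Literature.MathematicalPhysics.QuantumFieldTheory.BalabanImbrieJaffe1984to88.BIJ85Eq716ConfigLaplacian
open Literature.MathematicalPhysics.QuantumFieldTheory.BalabanImbrieJaffe1984to88.BIJ85MomentumSymbols71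
open Literature.MathematicalPhysics.QuantumFieldTheory.BalabanImbrieJaffe1984to88.BIJ85MomentumSymbols6I

noncomputable section

variable {d : ℕ} (n : ℕ) [NeZero n] (M : Fin d → ℕ) [hM : ∀ μ, NeZero (M μ)] (m : Type*) [Fintype m] [DecidableEq m]

/-! ## §1 The reduced momentum of `p′ + l` on the fine torus -/

/-- On the η-lattice torus the reduced momentum `s` of the dual point `p′ + l ↔ pOf (k, q)` satisfies
`e^{i s_ν} = ω_ν = e^{iη(p′_ν + 2πk_ν)}` (`B5Block118.om`). [cite: BalabanImbrieJaffe1985, (7.1.4) p.322] -/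
theorem exp_sOf_pOf (k : Fin d → Fin n) (q : Tor M) (ν : Fin d) :
    Complex.exp (Complex.I * ((sOf (fine n M) (pOf n M (k, q)) ν : ℝ) : ℂ)) = om n k (sOf M q) ν := by
  rw [← chi_unitVec_eq_exp, chi_unitVec]
  have h := stdAddChar_pOf_mul_natCast n M k q ν 1
  rwa [pow_one, Nat.cast_one, mul_one] at h

/-- `n·(e^{is_ν} − 1) = ∂_ν(p′ + l)`: the unit-step symbol of the fine torus, scaled by the lattice factor `η^{−1} = n`, is r15's
(7.1.4) symbol `dSym (1/n)` at `p′ + l` (through seat p10's dictionary `dSym_eq_6I` to [Balaban1984PropagatorsI] (1.31)).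
[cite: BalabanImbrieJaffe1985, (7.1.4) p.322] -/
theorem natCast_mul_dOne_sOf_pOf (k : Fin d → Fin n) (q : Tor M) (ν : Fin d) :
    (n : ℂ) * dOne (sOf (fine n M) (pOf n M (k, q))) ν = dSym (1 / n) (B4Strip.shiftr n k (sOf M q)) ν := by
  rw [dSym_eq_6I (NeZero.ne n), B5Block118.dSym_eq_om, dOne, exp_sOf_pOf]

/-! ## §2 (7.1.4): the η-lattice forward difference in momentum space -/

omit [Fintype m] in
/-- **(7.1.4)** p. 322 [PDF 24], verbatim: *"the derivative ∂ can be represented by a diagonal d × d matrix ∂(p) with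
eigenvalues ∂_μ(p) = (exp(iηp_μ) − 1)/η. (7.1.4)"* — PROVED for the configuration-space operator on the η-lattice torus: the
symbol of `η^{−1}(S_ν − 1)` at the fine dual momentum `p′ + l` is `∂_ν(p′ + l)·1 = dSym (1/n) (p′ + l) ν·1`.
[cite: BalabanImbrieJaffe1985, (7.1.4) p.322] -/
theorem symb_fdiffC_fine (ν : Fin d) (k : Fin d → Fin n) (q : Tor M) :
    symb (fine n M) m ((n : ℂ) • fdiffC (fine n M) m ν) (pOf n M (k, q))
      = dSym (1 / n) (B4Strip.shiftr n k (sOf M q)) ν • (1 : Matrix m m ℂ) := by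
  rw [← symbR_eq_symb, symbR_smul, symbR_eq_symb, symb_fdiffC, smul_smul, natCast_mul_dOne_sOf_pOf]

/-- (7.1.4) as the momentum representation: `(F⊗1)(η^{−1}(S_ν − 1)f)(p′+l, i) = ∂_ν(p′+l)·f̂_i(p′+l)`.
[cite: BalabanImbrieJaffe1985, (7.1.4) p.322] -/
theorem dftC_fdiffC_fine_mulVec (ν : Fin d) (f : Tor (fine n M) × m → ℂ) (k : Fin d → Fin n) (q : Tor M) (i : m) :
    (dftC (fine n M) m *ᵥ (((n : ℂ) • fdiffC (fine n M) m ν) *ᵥ f)) (pOf n M (k, q), i)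
      = dSym (1 / n) (B4Strip.shiftr n k (sOf M q)) ν * (dftC (fine n M) m *ᵥ f) (pOf n M (k, q), i) := by
  rw [Matrix.smul_mulVec, Matrix.mulVec_smul, Pi.smul_apply, dftC_fdiffC_mulVec, smul_eq_mul, ← mul_assoc,
    natCast_mul_dOne_sOf_pOf]

/-! ## §3 (7.1.6), η-member: the η-Laplacian `Σ_ν ∂_ν^*∂_ν` in momentum space -/

/-- `Δ(p′ + l) = n²·Δ^{(1),η‑torus}(s)`: r15's `lapSym (1/n)` at `p′ + l` is `n²` times the unit-step Laplacian symbol of the fine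
torus at its reduced momentum. [cite: BalabanImbrieJaffe1985, (7.1.6) p.322] -/
theorem lapSym_shiftr_eq (k : Fin d → Fin n) (q : Tor M) :
    lapSym (1 / n) (B4Strip.shiftr n k (sOf M q)) = (n : ℝ) ^ 2 * lapOne (sOf (fine n M) (pOf n M (k, q))) := by
  rw [lapSym, lapOne, Finset.mul_sum]
  refine Finset.sum_congr rfl fun μ _ => ?_
  rw [← natCast_mul_dOne_sOf_pOf, norm_mul, Complex.norm_natCast, mul_pow]

/-- **(7.1.6)**, η-member, p. 322 [PDF 24]: *"Δ(p) = Tr ∂(p)^*∂(p)"* — PROVED for the configuration-space η-Laplacian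
`Σ_ν (η^{−1}∂_ν)^*(η^{−1}∂_ν)` on the η-lattice torus: its symbol at `p′ + l` is `Δ(p′+l)·1 = lapSym (1/n) (p′+l)·1`
(= `Σ_μ |∂_μ(p′+l)|²`, the printed trace by r15's `trace_dMat`). [cite: BalabanImbrieJaffe1985, (7.1.6) p.322] -/
theorem symb_laplace_fine (k : Fin d → Fin n) (q : Tor M) :
    symb (fine n M) m (∑ ν : Fin d, ((n : ℂ) • fdiffC (fine n M) m ν)ᴴ * ((n : ℂ) • fdiffC (fine n M) m ν)) (pOf n M (k, q))
      = ((lapSym (1 / n) (B4Strip.shiftr n k (sOf M q)) : ℝ) : ℂ) • (1 : Matrix m m ℂ) := by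
  have h : ∀ ν : Fin d, ((n : ℂ) • fdiffC (fine n M) m ν)ᴴ * ((n : ℂ) • fdiffC (fine n M) m ν)
      = ((n : ℂ) * n) • ((fdiffC (fine n M) m ν)ᴴ * fdiffC (fine n M) m ν) := by
    intro ν
    rw [Matrix.conjTranspose_smul, Matrix.smul_mul, Matrix.mul_smul, smul_smul, Complex.star_def, Complex.conj_natCast]
  simp_rw [h]
  rw [← Finset.smul_sum, ← symbR_eq_symb, symbR_smul, symbR_eq_symb, symb_laplaceOne, smul_smul, lapSym_shiftr_eq]
  congr 1
  push_cast
  ring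

end

end Literature.MathematicalPhysics.QuantumFieldTheory.BalabanImbrieJaffe1984to88.BIJ85Eq714FineTorus
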